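import Summits.BirchSwinnertonDyer.BirchSwinnertonDyer.Theorems.PrintCFramBottomClassIndexLawFiveLeLevelDictionaryAlpha
import Summits.BirchSwinnertonDyer.BirchSwinnertonDyer.Theorems.PrintCFramBottomClassIndexLawFiveLeHerbrandConjugationSwapRational
import Literature.NumberTheory.EllipticCurves.SelmerFiniteProofs
import Literature.NumberTheory.EllipticCurves.SelmerLocalRestrictionKernel
import Literature.NumberTheory.EllipticCurves.CasselsTateSelmerKolyvaginValue
import Literature.NumberTheory.EllipticCurves.SelmerCorankAssembly
import Literature.NumberTheory.EllipticCurves.LocalPointsPlaceTransportProofs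
import Literature.NumberTheory.EllipticCurves.StrictSelmerTorsionLevelUniformBound
import Summits.BirchSwinnertonDyer.BirchSwinnertonDyer.Theorems.RamifiedSevenEllipticUnitsStrictControlAnyPrime
import HarnessLib

/-!
# Route `PrintCFram`, crux C2 `BottomClassIndexLawFiveLe` (stmt-BirchSwinnertonDyer-20372), line
# `eisenstein-resource-bdp-line` (registry v18/v19; LEAD g10 report §2(d), the LEVEL DICTIONARY (α′)): **THE STRICT `p`-SELMER
# GROUP VANISHES ON THE KRIZ–LI LOCUS** — for a member of the CM-ramified class with UNIT class factor `B_{1,ψ⁻¹}`, every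
# `p`-Selmer class of `W/ℚ` which is locally trivial at `p` is `0`; hence `#Sel_p(W/ℚ) ≤ p`, and a member carrying a rational point
# not `p`-divisible in `W(ℚ)` has **`Ш(W/ℚ)[p] = 0`** — by descent alone (Kriz–Li-free, Mazur–Wiles-free, `L`-value-free)
# (cell `bsd-print-cfram`, width seat `bsd-line-cfram-p1-w6` g3; helper `--supports` 20372; 0 defs, 0 facts, 0 sorry)

HONEST FRAMING. Nothing about BSD is proved here and no stub of the line is closed; BSD is not proved by any of this. This is the
SELMER form of the (α) consumer (`…LevelDictionaryAlpha.norm_bernoulliOnePrim_le_of_level_pos`): the same pipeline with the Kummer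
class of a level-`≥ 1` point replaced by ANY `p`-Selmer class locally trivial at `p`. READING for the line (LEAD g10/g11): on the
Kriz–Li locus (unit class factor) not only the crux's level binder `n` vanishes (file 4) but the whole ALGEBRAIC `p`-part is rigid:
`Sel_p(W/ℚ) = 𝔽_p·δ(P)` and `Ш(W/ℚ)[p] = 0` for every member with a non-`p`-divisible rational point — so on the locus Kriz–Li's
Thm 1.20 serves ONLY the analytic statement `ord_p Ш_an(W) = 0`; and w3 g8's primitivity socket
(`ParitySplitPrimitivity.bsdp_cmRamified_of_heegnerIndex_of_natCard_selmerGroup_le_pair`) has its two Selmer-size hypotheses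
(`#Sel_p(W) ≤ p²`, `#Sel_p(W^{(d)}) ≤ p`) DISCHARGED whenever the class factor of `W` resp. of the twist is a unit.

* §1 (generic, any number field `K`, `W/K` elliptic, `m ≠ 0`, `Φ ≤ W[m]` stable) **`unramified_quot_or_sub_of_class`** — w4 g8's
  (α-W) `unramified_quot_or_sub_of_kummer_line` for an ARBITRARY continuous 1-cocycle `z` of `W[m]` with non-zero class which is
  unramified at the good places prime to `m` (`unramifiedKer`) and locally trivial (`torsionLocalKer`) at the others, the quotient
  having no inertia invariants there: an everywhere-unramified non-zero class for `Φ.Quot` or for `Φ.Sub`.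
* §2 ON THE CLASS over `ℚ`: `false_of_unramified_quot_or_sub_of_unit_classFactor` (the four-branch engine block of file 4, with the
  dichotomy as hypothesis), **`selmer_eq_zero_of_mem_torsionLocalKer_of_unit_classFactor`** (a `p`-Selmer class locally trivial at the
  place above `p` is `0`), **`selmerResKer_eq_bot_of_unit_classFactor`** (Bhargava–Skinner's `Z_p(W) = 0`),
  **`natCard_selmerGroup_le_of_unit_classFactor`** (`#Sel_p(W/ℚ) ≤ p`, via `natCard_selmerGroup_le_prime_mul_of_natCard_torsion_eq_one`
  and `W(ℚ_p)[p] = 0`).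
* (companion file `…LevelDictionaryStrictSelmerSha`) `sha_torsion_eq_zero_of_unit_classFactor` — with a rational point `P`,
  `∀ R, pR ≠ P`: every `s ∈ Ш(W/ℚ)` with `p • s = 0` is `0` (`Sel_p = 𝔽_p·δ(P)` and `Sel_p ↠ Ш[p]`).

THEOREMS ONLY; no definition, no named fact, no `sorry`. No summit statement is proved by this seat. References:
[SilvermanAEC2009] X.§4 (Thm. X.4.2, Cor. X.4.4), VIII.§2; [BhargavaSkinner2014] proof of Lemma 16; [MilneADT2006] I Lemma 3.3;
[Washington1997] §6.3, §10.2; [GreenbergLNM1716] §3; the LEAD g10 report §2(d) and the w6 g3 crux notes.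
-/

set_option autoImplicit false
-- `…BirchSwinnertonDyer.BirchSwinnertonDyer.Theorems…` is the problem's mandated namespace (D-0017).
set_option linter.dupNamespace false

noncomputable section

open scoped Classical Pointwise

namespace Summit.BirchSwinnertonDyer.BirchSwinnertonDyer.Theorems.PrintCFram.LevelDictionaryAlpha

open NumberField IsDedekindDomain Field WeierstrassCurve DirichletCharacter
open Literature.NumberTheory.EllipticCurves Literature.NumberTheory.GaloisRepresentations
  Literature.NumberTheory.EllipticCurves.Rank1Residual Literature.NumberTheory.EllipticCurves.KrizLi2019
  Literature.NumberTheory.EllipticCurves.GreenbergSelmer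
open Summit.BirchSwinnertonDyer.Rank1Residual
open Summit.BirchSwinnertonDyer.BirchSwinnertonDyer.Theorems.PrintCFram.HerbrandSelmerToHom

universe u

/-! ## §1 Generic: an everywhere-unramified class for the quotient or the sub, from ANY class unramified at the good places and
locally trivial elsewhere -/

section Generic

variable {K : Type u} [Field K] [NumberField K] (W : WeierstrassCurve K) [W.IsElliptic]

/-- **(α-W) for an arbitrary class.** `K` a number field, `W/K` elliptic, `m ≠ 0`, `Φ ≤ W[m]` a `Γ_K`-stable subgroup, `z` a continuous
crossed homomorphism `Γ_K → W[m]` with NON-ZERO class such that: at every good place `v ∤ m` the class is UNRAMIFIED above `v`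
(`unramifiedKer`, e.g. a Selmer class, *AEC* X.4.4); at every other finite place the class lies in `torsionLocalKer W K_v m` (locally
trivial) and `Φ.Quot` has no non-zero `I_𝔓`-invariant for `𝔓 ∣ v`. Then EITHER the push-forward of `z` to `Φ.Quot` has non-zero class
and is a coboundary on every inertia group, OR some continuous crossed homomorphism `w : Γ_K → Φ.Sub`, equal to `z − ∂m₁` inside `W[m]`,
has non-zero class and is a coboundary on every inertia group. (w4 g8's `unramified_quot_or_sub_of_kummer_line` is the case of a Kummer
cocycle; same proof on (α-core) `unramified_quot_or_sub_of_locally_trivial`.) [cite: SilvermanAEC2009, X.§4 (Cor. X.4.4) and VIII.§2]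
[cite: GreenbergLNM1716, §3 (PDF p. 86)] [cite: SerreGaloisCohomology1997, I.§2.6 (b) and I.§5.1] -/
theorem unramified_quot_or_sub_of_class {m : ℕ} (hm : m ≠ 0)
    (Φ : X2.ResidualDevissageModules.StableSubgroup (absoluteGaloisGroup K) (geomTorsion W (m : ℤ)))
    (z : contOneCocycles (discreteTopRep (absoluteGaloisGroup K) (geomTorsion W (m : ℤ))))
    (hz : oneCocycleClass _ z ≠ 0)
    (hunr : ∀ v : HeightOneSpectrum (𝓞 K), (W.HasGoodReductionAt v ∧ ((m : ℕ) : 𝓞 K) ∉ v.asIdeal) →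
      ∀ 𝔓 ∈ v.primesAbove, oneCocycleClass _ z ∈ unramifiedKer (geomTorsion W (m : ℤ)) 𝔓)
    (hloc : ∀ v : HeightOneSpectrum (𝓞 K), ¬ (W.HasGoodReductionAt v ∧ ((m : ℕ) : 𝓞 K) ∉ v.asIdeal) →
      oneCocycleClass _ z ∈ W.torsionLocalKer (v.adicCompletion K) (m : ℤ))
    (hQI : ∀ v : HeightOneSpectrum (𝓞 K), ¬ (W.HasGoodReductionAt v ∧ ((m : ℕ) : 𝓞 K) ∉ v.asIdeal) →
      ∀ 𝔓 ∈ v.primesAbove, ∀ q : Φ.Quot,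
        (∀ g ∈ 𝔓.inertia (absoluteGaloisGroup K), g • q = q) → q = 0) :
    (∃ zq : contOneCocycles (discreteTopRep (absoluteGaloisGroup K) Φ.Quot),
      (∀ g, zq.1 g = Φ.proj (z.1 g)) ∧
      oneCocycleClass _ zq ≠ 0 ∧
      ∀ (v : HeightOneSpectrum (𝓞 K)) (𝔓 : Ideal (absIntegers (𝓞 K) K)), 𝔓 ∈ v.primesAbove →
        ∃ q : Φ.Quot, ∀ g ∈ 𝔓.inertia (absoluteGaloisGroup K), zq.1 g = g • q - q) ∨
    (∃ (w : contOneCocycles (discreteTopRep (absoluteGaloisGroup K) Φ.Sub)) (m₁ : geomTorsion W (m : ℤ)),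
      oneCocycleClass _ w ≠ 0 ∧
      (∀ (v : HeightOneSpectrum (𝓞 K)) (𝔓 : Ideal (absIntegers (𝓞 K) K)), 𝔓 ∈ v.primesAbove →
        ∃ s : Φ.Sub, ∀ g ∈ 𝔓.inertia (absoluteGaloisGroup K), w.1 g = g • s - s) ∧
      ∀ g, Φ.incl (w.1 g) = z.1 g - (g • m₁ - m₁)) := by
  -- the family of inertia groups of all primes of `\bar ℤ_K`
  set 𝓘 : Set (Subgroup (absoluteGaloisGroup K)) :=
    {I | ∃ (v : HeightOneSpectrum (𝓞 K)) (𝔓 : Ideal (absIntegers (𝓞 K) K)),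
      𝔓 ∈ v.primesAbove ∧ I = 𝔓.inertia (absoluteGaloisGroup K)} with h𝓘
  have hmem : ∀ (v : HeightOneSpectrum (𝓞 K)) (𝔓 : Ideal (absIntegers (𝓞 K) K)), 𝔓 ∈ v.primesAbove →
      𝔓.inertia (absoluteGaloisGroup K) ∈ 𝓘 := fun v 𝔓 h𝔓 ↦ ⟨v, 𝔓, h𝔓, rfl⟩
  -- the data of (α-core)
  have hι : ∀ (g : absoluteGaloisGroup K) (s : Φ.Sub), Φ.incl (g • s) = g • Φ.incl s := fun _ _ ↦ rfl
  have hπ : ∀ (g : absoluteGaloisGroup K) (x : geomTorsion W (m : ℤ)), Φ.proj (g • x) = g • Φ.proj x :=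
    fun _ _ ↦ rfl
  have hιinj : Function.Injective Φ.incl := fun a b h ↦ Subtype.ext h
  have hπsurj : Function.Surjective Φ.proj := QuotientAddGroup.mk'_surjective _
  have hπι : ∀ s : Φ.Sub, Φ.proj (Φ.incl s) = 0 := fun s ↦
    (QuotientAddGroup.eq_zero_iff _).mpr s.2
  have hker : ∀ x : geomTorsion W (m : ℤ), Φ.proj x = 0 → ∃ s : Φ.Sub, Φ.incl s = x := fun x hx ↦
    ⟨⟨x, (QuotientAddGroup.eq_zero_iff x).mp hx⟩, rfl⟩
  have hQ𝓘 : ∀ I ∈ 𝓘, (∀ q : Φ.Quot, (∀ g ∈ I, g • q = q) → q = 0) ∨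
      (∀ g ∈ I, ∀ x : geomTorsion W (m : ℤ), g • x = x) := by
    rintro I ⟨v, 𝔓, h𝔓, rfl⟩
    by_cases hgood : W.HasGoodReductionAt v ∧ ((m : ℕ) : 𝓞 K) ∉ v.asIdeal
    · exact Or.inr fun g hg x ↦ W.smul_geomTorsion_eq_of_mem_inertia hgood.1
        (n := (m : ℤ)) (by exact_mod_cast hgood.2) h𝔓 hg x
    · exact Or.inl (hQI v hgood 𝔓 h𝔓)
  have hzloc : ∀ I ∈ 𝓘, ∃ x : geomTorsion W (m : ℤ), ∀ g ∈ I, z.1 g = g • x - x := by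
    rintro I ⟨v, 𝔓, h𝔓, rfl⟩
    by_cases hgood : W.HasGoodReductionAt v ∧ ((m : ℕ) : 𝓞 K) ∉ v.asIdeal
    · obtain ⟨a, ha⟩ := (oneCocycleClass_mem_subgroupResKer_iff _ z).1 (hunr v hgood 𝔓 h𝔓)
      exact ⟨a, fun g hg ↦ ha ⟨g, hg⟩⟩
    · exact LevelDictionary.coboundaryOn_inertia_of_mem_torsionLocalKer W hm v z (hloc v hgood) h𝔓
  -- (α-core)
  rcases LevelDictionary.unramified_quot_or_sub_of_locally_trivial (LevelDictionary.continuous_smul_geomTorsion W (m : ℤ))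
      Φ.incl Φ.proj hι hπ hιinj hπsurj hπι hker 𝓘 hQ𝓘 z hz hzloc with ⟨hq, hqloc⟩ | ⟨w, m₁, hw, hwloc, hwz⟩
  · refine Or.inl ⟨contOneCocycles.pullback (ContinuousMonoidHom.id _)
      (resHomOfEquivariant (ContinuousMonoidHom.id _) Φ.proj hπ) z, fun g ↦ rfl, hq, fun v 𝔓 h𝔓 ↦ ?_⟩
    exact hqloc _ (hmem v 𝔓 h𝔓)
  · exact Or.inr ⟨w, m₁, hw, fun v 𝔓 h𝔓 ↦ hwloc _ (hmem v 𝔓 h𝔓), hwz⟩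

end Generic

/-! ## §2 On the class over `ℚ`: a `p`-Selmer class locally trivial at `p` vanishes on the Kriz–Li locus -/

section StrictSelmer

variable (W : WeierstrassCurve ℚ) [W.IsElliptic] [W.IsGloballyMinimal] (p : ℕ) [hp : Fact p.Prime]

/-- **THE STRICT `p`-SELMER GROUP VANISHES ON THE KRIZ–LI LOCUS.** Let `W/ℚ` be globally minimal with CM, `p ≥ 5` ramified in the CM
field, `(f, ψ, ω)` a Kriz–Li character datum with `ψ` ODD, `ω` Teichmüller and `hss`, and suppose the CLASS FACTOR is a UNIT
(`¬ ‖B_{1,ψ⁻¹}‖_p ≤ p⁻¹`). Then every class `c ∈ Sel_p(W/ℚ) ⊂ H¹(ℚ, W[p])` which is locally trivial at the place above `p`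
(`c ∈ torsionLocalKer W ℚ_v p`, i.e. `res_p c = 0`) is ZERO. Proof: a representative cocycle is unramified at the good `ℓ ≠ p`
(*AEC* X.4.4, `selmerGroup_le_h1Unramified_holds`), locally trivial at the bad `ℓ ≠ p` (`W(ℚ_ℓ)[p] = 0`, file 1) and at `p`
(hypothesis); §1 gives an everywhere-unramified non-zero class for one of the two line characters `θ_S = b∘χ_m`,
`θ_Q = χ̄_p(b∘χ_m)⁻¹` (file 3), whose Dirichlet avatars are `~ψ` (odd) and `~ψ⁻¹ω` (even) in some order; a unit `B_{1,ψ⁻¹}` feeds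
file 2's ODD / EVEN engines: contradiction. (File 4's `norm_bernoulliOnePrim_le_of_level_pos` is the case of the Kummer class of a
level-`≥ 1` point.) [cite: SilvermanAEC2009, X.§4 (Cor. X.4.4) and VIII.§2] [cite: Washington1997, §6.3 and §10.2]
[cite: KrizLi2019, §1.5 (p. 7) and §7.1 (p. 43)] -/
theorem selmer_eq_zero_of_mem_torsionLocalKer_of_unit_classFactor (hCM : W.HasCM) (hram : CMRamified W p) (h5 : 5 ≤ p)
    {f : ℕ} [NeZero f] (ψ : DirichletCharacter ℚ_[p] f) (ω : DirichletCharacter ℚ_[p] p)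
    (hψ : ψ.Odd) (hω : IsTeichmullerCharacter ω)
    (hss : ∀ ℓ : ℕ, ℓ.Prime → ¬ (ℓ ∣ p * W.conductorNorm ℤ) →
      ‖((W.LFunction ℓ : ℤ) : ℚ_[p]) - (ψ (ℓ : ZMod f) + ψ⁻¹ (ℓ : ZMod f) * ω (ℓ : ZMod p))‖ < 1)
    (hcls : ¬ ‖bernoulliOnePrim ψ⁻¹‖ ≤ (p : ℝ)⁻¹)
    {ξ : galH1Torsion W (p : ℤ)} (hsel : ξ ∈ selmerGroup W (p : ℤ))
    (hres : ∀ v : HeightOneSpectrum (𝓞 ℚ), ((p : ℕ) : 𝓞 ℚ) ∈ v.asIdeal →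
      ξ ∈ W.torsionLocalKer (v.adicCompletion ℚ) (p : ℤ)) :
    ξ = 0 := by
  by_contra hξ0

  have hpr : p.Prime := hp.out
  have hp2 : p ≠ 2 := by omega
  have hp0 : (p : ℤ) ≠ 0 := by exact_mod_cast hpr.ne_zero
  haveI hpne : NeZero p := ⟨hpr.ne_zero⟩
  have hωodd : ω.Odd := KrizLiBinders.teichmuller_apply_neg_one hp2 hω
  -- `B_{1,ψ⁻¹}` is `p`-integral; suppose it is a unit
  have hne : ¬ ψ.Even := EisensteinPair.not_even_of_odd' ψ hψ
  obtain ⟨ha, -⟩ := BernoulliUnits.norm_bernoulliPair_le_one_of_hss W hCM hram h5 hω ψ hss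
    (1 : DirichletCharacter ℚ_[p] 1) (fun h ↦ hpr.one_lt.ne' (Nat.dvd_one.mp h))
  rw [RegularLocusBernoulliPair.bernoulliOnePrim_bernoulliCharOne_of_not_even ψ _ hne] at ha
  have hB1 : ‖bernoulliOnePrim ψ⁻¹‖ = 1 := by
    by_contra h1
    exact hcls (norm_le_inv_of_norm_lt_one (lt_of_le_of_ne ha h1))
  -- the rational line, its characters and avatars
  obtain ⟨Φ, θS, θQ, m, hmz, b, ψ₁, hfM, hmM, hpM, hcard, hθS, hkerS, hθQ, hkerQ, hprod, hSb, hQb, hψ₁, e⟩ :=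
    exists_rationalLineData_of_hss p W hCM h5 hram ψ ω hω hss
  have hcardQ : Nat.card Φ.Quot = p := HerbrandLineRestriction.natCard_quot_eq_of_card_sub W Φ hcard
  have hcontS : ∀ x : Φ.Sub, Continuous fun g : absoluteGaloisGroup ℚ ↦ g • x :=
    Φ.continuous_smul_sub (LevelDictionary.continuous_smul_geomTorsion W (p : ℤ))
  have hcontQ : ∀ y : Φ.Quot, Continuous fun g : absoluteGaloisGroup ℚ ↦ g • y :=
    Φ.continuous_smul_quot (LevelDictionary.continuous_smul_geomTorsion W (p : ℤ))
  -- a place of `ℚ` above `p`, a prime of `\bar ℤ` above it: non-trivial action and the decomposition witnesses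
  obtain ⟨v₀, hv₀⟩ := Literature.NumberTheory.NumberFields.RingOfIntegers.exists_heightOneSpectrum_natCast_mem ℚ hpr
  obtain ⟨𝔓₀, h𝔓₀⟩ := v₀.primesAbove_nonempty
  obtain ⟨g₀, -, -, c₀, hc₀, hg₀⟩ := BorelTorsion.exists_sq_mem_inertia_homothety (W := W) p hCM h5 hram hv₀ h𝔓₀
  have hntS : ∃ (g : absoluteGaloisGroup ℚ) (x : Φ.Sub), g • x ≠ x := by
    haveI : Finite Φ.Sub := Nat.finite_of_card_ne_zero (by rw [hcard]; exact hpr.ne_zero)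
    haveI : Nontrivial Φ.Sub := Finite.one_lt_card_iff_nontrivial.mp (by rw [hcard]; exact hpr.one_lt)
    obtain ⟨x, hx⟩ := exists_ne (0 : Φ.Sub)
    exact ⟨g₀, x, HerbrandInertiaAtP.smul_ne_sub_of_homothety W Φ hcard hc₀ hg₀ hx⟩
  have hntQ : ∃ (g : absoluteGaloisGroup ℚ) (y : Φ.Quot), g • y ≠ y := by
    haveI : Finite Φ.Quot := Nat.finite_of_card_ne_zero (by rw [hcardQ]; exact hpr.ne_zero)
    haveI : Nontrivial Φ.Quot := Finite.one_lt_card_iff_nontrivial.mp (by rw [hcardQ]; exact hpr.one_lt)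
    obtain ⟨y, hy⟩ := exists_ne (0 : Φ.Quot)
    exact ⟨g₀, y, HerbrandInertiaAtP.smul_ne_quot_of_homothety W Φ hcard hc₀ hg₀ hy⟩
  have HS : ∀ (ℓ : HeightOneSpectrum (𝓞 ℚ)), ((p : ℕ) : 𝓞 ℚ) ∈ ℓ.asIdeal → ∀ 𝔓 ∈ ℓ.primesAbove,
      ∃ g ∈ 𝔓.decompositionSubgroup (absoluteGaloisGroup ℚ), θS g ≠ modNCyclotomicCharacter ℚ p g :=
    fun ℓ hℓ 𝔓 h𝔓 ↦ (exists_mem_decompositionSubgroup_apply_ne_cyclotomic_at_p W Φ hCM h5 hram hcard θS θQ hθS hθQ hprod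
      hℓ h𝔓).1
  have HQ : ∀ (ℓ : HeightOneSpectrum (𝓞 ℚ)), ((p : ℕ) : 𝓞 ℚ) ∈ ℓ.asIdeal → ∀ 𝔓 ∈ ℓ.primesAbove,
      ∃ g ∈ 𝔓.decompositionSubgroup (absoluteGaloisGroup ℚ), θQ g ≠ modNCyclotomicCharacter ℚ p g :=
    fun ℓ hℓ 𝔓 h𝔓 ↦ (exists_mem_decompositionSubgroup_apply_ne_cyclotomic_at_p W Φ hCM h5 hram hcard θS θQ hθS hθQ hprod
      hℓ h𝔓).2
  -- a complex conjugation and the parities of the two characters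
  obtain ⟨c, hc⟩ := exists_isComplexConjugation (Rat.castHom ℝ)
  have hmc : modNCyclotomicCharacter ℚ m c = -1 :=
    Units.ext (by rw [Units.val_neg, Units.val_one]; exact modNCyclotomicCharacter_of_isComplexConjugation hc)
  have hpc : modNCyclotomicCharacter ℚ p c = -1 :=
    Units.ext (by rw [Units.val_neg, Units.val_one]; exact modNCyclotomicCharacter_of_isComplexConjugation hc)
  have hSc : θS c = b (-1) := by rw [hSb c, hmc]
  have hQc : θQ c = -1 * (b (-1))⁻¹ := by rw [hQb c, hpc, hmc]
  have hpar := BernoulliUnits.odd_iff_of_teichmuller_lift hp2 b hψ₁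
  -- the avatars: `ψ₁` for `θS`, `λ₃ = ψ₁⁻¹↑·ω↑` (level `m·p`) for `θQ`
  haveI : NeZero (m * p) := ⟨Nat.mul_ne_zero (NeZero.ne m) hpr.ne_zero⟩
  have hlamS : ∀ τ : absoluteGaloisGroup ℚ, ψ₁ ((modNCyclotomicCharacter ℚ m τ : (ZMod m)ˣ) : ZMod m) =
      (((Kato2004.teichmullerChar p (θS τ) : ℤ_[p]ˣ) : ℤ_[p]) : ℚ_[p]) := fun τ ↦ by rw [hSb τ, hψ₁]
  set lam₃ : DirichletCharacter ℚ_[p] (m * p) := changeLevel (dvd_mul_right m p) ψ₁⁻¹ * changeLevel (dvd_mul_left p m) ω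
    with hlam₃
  have el₃ : changeLevel (dvd_refl (m * p)) lam₃ = changeLevel (dvd_mul_right m p) ψ₁⁻¹ * changeLevel (dvd_mul_left p m) ω := by
    rw [hlam₃, changeLevel_self]
  have hlamQ : ∀ τ : absoluteGaloisGroup ℚ, lam₃ ((modNCyclotomicCharacter ℚ (m * p) τ : (ZMod (m * p))ˣ) : ZMod (m * p)) =
      (((Kato2004.teichmullerChar p (θQ τ) : ℤ_[p]ˣ) : ℤ_[p]) : ℚ_[p]) := fun τ ↦ by
    rw [hQb τ]
    exact (BernoulliUnits.avatar_level_of_lift_psiInvOmega hp2 b hψ₁ hω (dvd_refl (m * p)) (dvd_mul_right m p)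
      (dvd_mul_left p m) lam₃ el₃ τ).symm
  -- common-level bookkeeping (`M = f·m·p`)
  have hmpM : m * p ∣ f * m * p := ⟨f, by ring⟩
  have h1M : 1 ∣ f * m * p := one_dvd _
  have hf1M : f * 1 ∣ f * m * p := by rw [mul_one]; exact hfM
  have hL₃ : changeLevel hmpM lam₃ = changeLevel hmM ψ₁⁻¹ * changeLevel hpM ω := by
    rw [hlam₃, map_mul, ← changeLevel_trans, ← changeLevel_trans]
  -- the class `ξ`, a representative cocycle, and the hypotheses of (α-W) for an arbitrary class
  have hp0n : (p : ℕ) ≠ 0 := hpr.ne_zero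
  set z := reprCocycle W (p : ℤ) ξ with hzdef
  have hzc : oneCocycleClass _ z = ξ := oneCocycleClass_reprCocycle W (p : ℤ) ξ
  have hz0 : oneCocycleClass _ z ≠ 0 := by rw [hzc]; exact hξ0
  -- Selmer classes are unramified at the good places prime to `p` (AEC X.4.4)
  set S : Set (HeightOneSpectrum (𝓞 ℚ)) := {v | ¬ (W.HasGoodReductionAt v ∧ ((p : ℕ) : 𝓞 ℚ) ∉ v.asIdeal)} with hS
  have hunrS : ξ ∈ h1Unramified (geomTorsion W (p : ℤ)) S :=
    W.selmerGroup_le_h1Unramified_holds (n := (p : ℤ)) hp0 (S := S) (fun v hv ↦ fun h ↦ hv h.1)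
      (fun v hv ↦ fun h ↦ h.2 (by rw [← Int.cast_natCast]; exact hv)) hsel
  have hunr : ∀ v : HeightOneSpectrum (𝓞 ℚ), (W.HasGoodReductionAt v ∧ ((p : ℕ) : 𝓞 ℚ) ∉ v.asIdeal) →
      ∀ 𝔓 ∈ v.primesAbove, oneCocycleClass _ z ∈ unramifiedKer (geomTorsion W (p : ℤ)) 𝔓 := by
    intro v hv 𝔓 h𝔓
    rw [hzc]
    exact (mem_h1Unramified_iff.1 hunrS) v (fun h ↦ h hv) 𝔓 h𝔓
  have hloc : ∀ v : HeightOneSpectrum (𝓞 ℚ), ¬ (W.HasGoodReductionAt v ∧ ((p : ℕ) : 𝓞 ℚ) ∉ v.asIdeal) →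
      oneCocycleClass _ z ∈ W.torsionLocalKer (v.adicCompletion ℚ) (p : ℤ) := by
    intro v hv
    rw [hzc]
    by_cases hpv : ((p : ℕ) : 𝓞 ℚ) ∈ v.asIdeal
    · exact hres v hpv
    · have hbad : ¬ W.HasGoodReductionAt v := fun h ↦ hv ⟨h, hpv⟩
      exact W.mem_torsionLocalKer_adicCompletion_of_forall_nsmul_eq_zero (v := v) p hpv
        (forall_prime_nsmul_eq_zero_adicCompletion_of_bad (K := ℚ) W hCM hram h5 hpv hbad) _
  have hQI : ∀ v : HeightOneSpectrum (𝓞 ℚ), ¬ (W.HasGoodReductionAt v ∧ ((p : ℕ) : 𝓞 ℚ) ∉ v.asIdeal) →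
      ∀ 𝔓 ∈ v.primesAbove, ∀ q : Φ.Quot, (∀ g ∈ 𝔓.inertia (absoluteGaloisGroup ℚ), g • q = q) → q = 0 := by
    intro v hv 𝔓 h𝔓 q hq
    by_cases hpv : ((p : ℕ) : 𝓞 ℚ) ∈ v.asIdeal
    · exact quot_eq_zero_of_forall_inertia_smul_eq_at_p W Φ hCM h5 hram hcard hpv h𝔓 q hq
    · have hbad : ¬ W.HasGoodReductionAt v := fun h ↦ hv ⟨h, hpv⟩
      exact quot_eq_zero_of_forall_inertia_smul_eq_of_bad (K := ℚ) W Φ hCM hram h5 hpv hbad h𝔓 q hq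
  -- (α-W) for the class: an everywhere-unramified non-zero class for the quotient or for the sub

  rcases unramified_quot_or_sub_of_class W hp0n Φ z hz0 hunr hloc hQI with
    ⟨zq, -, hzq0, hzqI⟩ | ⟨w, -, hw0, hwI, -⟩
  · -- a class for `Φ.Quot`, character `θQ = χ̄_p (b∘χ_m)⁻¹`
    rcases e with e | e
    · -- `ψ ~ ψ₁` (odd): `θQ ~ ψ₁⁻¹ω` is EVEN — the EVEN engine with `λ₃`
      have hψ₁odd : ψ₁.Odd := by
        unfold DirichletCharacter.Odd
        rw [BernoulliUnits.apply_neg_one_eq_of_changeLevel_eq hmM ψ₁ e.symm, EisensteinPair.changeLevel_apply_neg_one]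
        exact hψ
      have hb1 : b (-1) = -1 := hpar.1.mp hψ₁odd
      have hθQc : θQ c = 1 := by rw [hQc, hb1, inv_neg, inv_one, neg_mul_neg, one_mul]
      have hL₃' : changeLevel hmpM lam₃ = changeLevel hfM ψ⁻¹ * changeLevel hpM ω := by
        rw [hL₃, map_inv, map_inv, ← e]
      have heven₃ : lam₃.Even := by
        unfold DirichletCharacter.Even
        rw [BernoulliUnits.apply_neg_one_eq_of_changeLevel_eq hmpM lam₃ hL₃', MulChar.mul_apply, map_inv,
          MulChar.inv_apply_eq_inv', EisensteinPair.changeLevel_apply_neg_one, EisensteinPair.changeLevel_apply_neg_one,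
          hψ, hωodd, inv_neg, inv_one, neg_mul_neg, one_mul]
      have hB₃ : ‖bernoulliOnePrim (changeLevel (dvd_mul_right (m * p) p) lam₃ *
          changeLevel (dvd_mul_left p (m * p)) ω⁻¹)‖ = 1 := by
        rw [BernoulliUnits.bernoulliOnePrim_mul_omegaInv_eq_of_lift_psiInvOmega hmpM hfM h1M hpM hf1M lam₃ ψ
          (1 : DirichletCharacter ℚ_[p] 1) ω hL₃' hψ,
          RegularLocusBernoulliPair.bernoulliOnePrim_bernoulliCharOne_of_not_even ψ _ hne]
        exact hB1
      exact false_of_unramified_class_of_even_avatar hp2 hcardQ hcontQ hntQ θQ hθQ hkerQ zq hzq0 hzqI hc hθQc HQ lam₃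
        hlamQ heven₃ hω hB₃
    · -- `ψ ~ ψ₁⁻¹ω`: `θQ ~ ψ₁⁻¹ω ~ ψ` is ODD — the ODD engine with `λ₃`
      have hL₃' : changeLevel hmpM lam₃ = changeLevel hfM ψ := by rw [hL₃, ← e]
      have hodd₃ : lam₃.Odd := by
        unfold DirichletCharacter.Odd
        rw [BernoulliUnits.apply_neg_one_eq_of_changeLevel_eq hmpM lam₃ hL₃', EisensteinPair.changeLevel_apply_neg_one]
        exact hψ
      have hB₃ : ‖bernoulliOnePrim lam₃⁻¹‖ = 1 := by
        rw [BernoulliUnits.bernoulliOnePrim_inv_eq_of_lift_psi hmpM hfM lam₃ ψ (1 : DirichletCharacter ℚ_[p] 1) hL₃' hψ,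
          RegularLocusBernoulliPair.bernoulliOnePrim_bernoulliCharOne_of_not_even ψ _ hne]
        exact hB1
      exact false_of_unramified_class_of_odd_avatar hp2 hcardQ hcontQ hntQ θQ hθQ hkerQ zq hzq0 hzqI lam₃ hlamQ hodd₃ hB₃
  · -- a class for `Φ.Sub`, character `θS = b∘χ_m`
    rcases e with e | e
    · -- `ψ ~ ψ₁`: `θS ~ ψ₁ ~ ψ` is ODD — the ODD engine with `ψ₁`
      have hψ₁odd : ψ₁.Odd := by
        unfold DirichletCharacter.Odd
        rw [BernoulliUnits.apply_neg_one_eq_of_changeLevel_eq hmM ψ₁ e.symm, EisensteinPair.changeLevel_apply_neg_one]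
        exact hψ
      have hB₁ : ‖bernoulliOnePrim ψ₁⁻¹‖ = 1 := by
        rw [BernoulliUnits.bernoulliOnePrim_inv_eq_of_lift_psi hmM hfM ψ₁ ψ (1 : DirichletCharacter ℚ_[p] 1) e.symm hψ,
          RegularLocusBernoulliPair.bernoulliOnePrim_bernoulliCharOne_of_not_even ψ _ hne]
        exact hB1
      exact false_of_unramified_class_of_odd_avatar hp2 hcard hcontS hntS θS hθS hkerS w hw0 hwI ψ₁ hlamS hψ₁odd hB₁
    · -- `ψ ~ ψ₁⁻¹ω`: `θS ~ ψ₁ ~ ψ⁻¹ω` is EVEN — the EVEN engine with `ψ₁`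
      have hL₁ : changeLevel hmM ψ₁ = changeLevel hfM ψ⁻¹ * changeLevel hpM ω := by
        rw [map_inv, e, map_inv, mul_inv, inv_inv, inv_mul_cancel_right]
      have hψ₁even : ψ₁.Even := by
        unfold DirichletCharacter.Even
        rw [BernoulliUnits.apply_neg_one_eq_of_changeLevel_eq hmM ψ₁ hL₁, MulChar.mul_apply, map_inv,
          MulChar.inv_apply_eq_inv', EisensteinPair.changeLevel_apply_neg_one, EisensteinPair.changeLevel_apply_neg_one,
          hψ, hωodd, inv_neg, inv_one, neg_mul_neg, one_mul]
      have hb1 : b (-1) = 1 := hpar.2.mp hψ₁even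
      have hθSc : θS c = 1 := by rw [hSc, hb1]
      have hB₁ : ‖bernoulliOnePrim (changeLevel (dvd_mul_right m p) ψ₁ * changeLevel (dvd_mul_left p m) ω⁻¹)‖ = 1 := by
        rw [BernoulliUnits.bernoulliOnePrim_mul_omegaInv_eq_of_lift_psiInvOmega hmM hfM h1M hpM hf1M ψ₁ ψ
          (1 : DirichletCharacter ℚ_[p] 1) ω hL₁ hψ,
          RegularLocusBernoulliPair.bernoulliOnePrim_bernoulliCharOne_of_not_even ψ _ hne]
        exact hB1
      exact false_of_unramified_class_of_even_avatar hp2 hcard hcontS hntS θS hθS hkerS w hw0 hwI hc hθSc HS ψ₁ hlamS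
        hψ₁even hω hB₁


/-- **Bhargava–Skinner's `Z_p(W) = 0` on the Kriz–Li locus**: the subgroup of `p`-Selmer classes with trivial restriction at the place
`v ∋ p` (`selmerResKer`) is trivial, for every member of the class with a unit class factor. [cite: BhargavaSkinner2014, Thm 7 (ii) and proof of Lemma 16]
[cite: SilvermanAEC2009, X.§4] -/
theorem selmerResKer_eq_bot_of_unit_classFactor (hCM : W.HasCM) (hram : CMRamified W p) (h5 : 5 ≤ p)
    {f : ℕ} [NeZero f] (ψ : DirichletCharacter ℚ_[p] f) (ω : DirichletCharacter ℚ_[p] p)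
    (hψ : ψ.Odd) (hω : IsTeichmullerCharacter ω)
    (hss : ∀ ℓ : ℕ, ℓ.Prime → ¬ (ℓ ∣ p * W.conductorNorm ℤ) →
      ‖((W.LFunction ℓ : ℤ) : ℚ_[p]) - (ψ (ℓ : ZMod f) + ψ⁻¹ (ℓ : ZMod f) * ω (ℓ : ZMod p))‖ < 1)
    (hcls : ¬ ‖bernoulliOnePrim ψ⁻¹‖ ≤ (p : ℝ)⁻¹)
    {v : HeightOneSpectrum (𝓞 ℚ)} (hv : ((p : ℕ) : 𝓞 ℚ) ∈ v.asIdeal) :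
    W.selmerResKer (p : ℤ) (v.adicCompletion ℚ) = ⊥ := by
  rw [eq_bot_iff]
  intro c hc
  rw [AddSubgroup.mem_bot]
  have hres : galoisCohomology.res (W.torsionGaloisModule (p : ℤ)) (v.adicCompletion ℚ) 1 (c : galH1Torsion W (p : ℤ)) = 0 :=
    (W.mem_selmerResKer_iff (p : ℤ) (v.adicCompletion ℚ) c).1 hc
  -- (`CharZero ℚ_v` is passed inline, NOT as a local instance/hypothesis: in the local context it would let `DivisionRing.toRatAlgebra`
  -- compete with the place's own `ℚ`-algebra structure `instAlgebraAdicCompletion` inside `torsionLocalKer`.)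
  have hv0 : (c : galH1Torsion W (p : ℤ)) ∈ W.torsionLocalKer (v.adicCompletion ℚ) (p : ℤ) :=
    (@mem_torsionLocalKer_iff_res_eq_zero ℚ _ W (v.adicCompletion ℚ) _ (_) _ _
      (charZero_of_injective_algebraMap (algebraMap ℚ (v.adicCompletion ℚ)).injective) p hp.out.ne_zero _).2 hres
  have hξ : (c : galH1Torsion W (p : ℤ)) = 0 :=
    selmer_eq_zero_of_mem_torsionLocalKer_of_unit_classFactor W p hCM hram h5 ψ ω hψ hω hss hcls c.2 fun v' hv' ↦ by
      rw [HerbrandSwap.heightOneSpectrum_rat_eq_of_natCast_mem (p := p) v' v hv' hv]; exact hv0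
  exact Subtype.ext (hξ.trans (ZeroMemClass.coe_zero _).symm)

/-- **`#Sel_p(W/ℚ) ≤ p` on the Kriz–Li locus.** For a member of the class with a unit class factor, the `p`-Selmer group of `W/ℚ` has at
most `p` elements: `#Sel_p ≤ p · #W(ℚ_p)[p] · #Z_p(W)` (Bhargava–Skinner / Milne I.3.3, tree
`natCard_selmerGroup_le_prime_mul_of_natCard_torsion_eq_one`) with `W(ℚ_p)[p] = 0` (`prime_nsmul_eq_zero_padic_of_hasCM_of_cmRamified`)
and `Z_p(W) = 0` (previous theorem). [cite: BhargavaSkinner2014, proof of Lemma 16] [cite: MilneADT2006, I Lemma 3.3] -/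
theorem natCard_selmerGroup_le_of_unit_classFactor (hCM : W.HasCM) (hram : CMRamified W p) (h5 : 5 ≤ p)
    {f : ℕ} [NeZero f] (ψ : DirichletCharacter ℚ_[p] f) (ω : DirichletCharacter ℚ_[p] p)
    (hψ : ψ.Odd) (hω : IsTeichmullerCharacter ω)
    (hss : ∀ ℓ : ℕ, ℓ.Prime → ¬ (ℓ ∣ p * W.conductorNorm ℤ) →
      ‖((W.LFunction ℓ : ℤ) : ℚ_[p]) - (ψ (ℓ : ZMod f) + ψ⁻¹ (ℓ : ZMod f) * ω (ℓ : ZMod p))‖ < 1)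
    (hcls : ¬ ‖bernoulliOnePrim ψ⁻¹‖ ≤ (p : ℝ)⁻¹) :
    Nat.card (selmerGroup W (p : ℤ)) ≤ p := by
  have hpr : p.Prime := hp.out
  obtain ⟨v, hv⟩ := Literature.NumberTheory.NumberFields.RingOfIntegers.exists_heightOneSpectrum_natCast_mem ℚ hpr
  have htors : Nat.card (nsmulAddMonoidHom p :
      (W.baseChange (v.adicCompletion ℚ)).toAffine.Point →+ _).ker = 1 :=
    (W.natCard_ker_nsmul_adicCompletion_eq_one_iff hv p).2
      (RamifiedSevenEllipticUnits.prime_nsmul_eq_zero_padic_of_hasCM_of_cmRamified W p hCM h5 hram)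
  have h := W.natCard_selmerGroup_le_prime_mul_of_natCard_torsion_eq_one hv htors
  rw [selmerResKer_eq_bot_of_unit_classFactor W p hCM hram h5 ψ ω hψ hω hss hcls hv, AddSubgroup.card_bot, mul_one] at h
  exact h

end StrictSelmer


end Summit.BirchSwinnertonDyer.BirchSwinnertonDyer.Theorems.PrintCFram.LevelDictionaryAlpha

end
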